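import Summits.BirchSwinnertonDyer.BirchSwinnertonDyer.Theorems.ClassRecordThreeEulerHalvesAtThreeEichlerShimuraTorsionCountE
import Summits.BirchSwinnertonDyer.BirchSwinnertonDyer.Theorems.ClassRecordThreeEulerHalvesAtThreeEichlerShimuraTorsionCountF
import HarnessLib

/-!
# The torsion-refined Shapiro count over a field `K`, part G: the EXACT count in characteristic zero

Helper file (route `ClassRecordThree`, crux `EulerHalvesAtThree`, print residue (SIGᶜ-lift)(ii); seat bsd-idea-10 g24, `--supports
stmt-BirchSwinnertonDyer-19109 --as helper`). For a finite-index level `Γ ≤ SL(2, ℤ)` with `-1 ∈ Γ` and a field `K` of CHARACTERISTIC `0`: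

  `six_mul_finrank_parTorsCocycles_eq`: `6 dim_K H¹_{par,tors}(Γ, K) + 3ν₂(Γ) + 4ν₃(Γ) + 6ε_∞(Γ) = 12 + [SL(2, ℤ) : Γ]`,

i.e. `dim_K {u : Γ → K additive, killing parabolic and finite-order elements} = 2g(X_Γ)` exactly (the `K`-version of the real count
`…EichlerShimuraLevelCountE.six_mul_finrank_parabolicCocycles_eq`; in characteristic `0` the torsion condition is automatic,
`mem_parTorsCocycles_of_charZero`). Ingredients: `Λ(u, f) = ((E_u + δf)(S), (E_u + δf)(T))` has `dim ker Λ = 1` and is ONTO the unrefined solution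
space `W₀` (`exists_rc`, part F), `dim W₀ = dim ker(1 + S^*) + dim(ker(1 + U + U²) ∩ ker(cusp sums))` and the trace counts (part E). For `K = ℚ` this
is the source of the `2g` INDEPENDENT INTEGRAL parabolic cocycles (part H) required by the lifting recipe of `…EichlerShimuraModLift`. No named facts;
nothing specific to BSD; no summit statement is proved.

## References
* G. Shimura, *Introduction to the arithmetic theory of automorphic functions* (1971), §8.1–8.2, Prop. 8.1, (8.2.24) [ShimuraIATAF1971].
* K. S. Brown, *Cohomology of groups* (1982), III.6 [Brown1982].
-/

noncomputable section

open scoped MatrixGroups ModularForm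

open CongruenceSubgroup Matrix.SpecialLinearGroup ModularGroup

set_option linter.dupNamespace false

namespace Summit.BirchSwinnertonDyer.BirchSwinnertonDyer.Theorems.EichlerShimuraLevelK

open _root_.Module _root_.LinearMap
open Literature.NumberTheory.EllipticCurves.ModularForms
open scoped Classical

variable {K : Type*} [Field K] {Γ : Subgroup SL(2, ℤ)}

/-! ### In characteristic zero the torsion condition is automatic -/

/-- `u(γⁿ) = n · u(γ)` for an additive `u`. [folklore] -/
theorem additive_map_pow {G : Type*} [Group G] {u : G → K} (hu : ∀ γ δ, u (γ * δ) = u γ + u δ) (γ : G) (n : ℕ) :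
    u (γ ^ n) = n * u γ := by
  induction n with
  | zero =>
    have h := hu 1 1
    rw [mul_one] at h
    rw [pow_zero, Nat.cast_zero, zero_mul]
    exact left_eq_add.mp h
  | succ n ih => rw [pow_succ, hu, ih, Nat.cast_succ]; ring

/-- **In characteristic `0` an additive map kills every element of finite order** (`n u(γ) = u(γⁿ) = u(1) = 0`). [folklore] -/
theorem additive_eq_zero_of_isOfFinOrder [CharZero K] {G : Type*} [Group G] {u : G → K} (hu : ∀ γ δ, u (γ * δ) = u γ + u δ)
    {γ : G} (hγ : IsOfFinOrder γ) : u γ = 0 := by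
  obtain ⟨n, hn, hγn⟩ := (isOfFinOrder_iff_pow_eq_one.mp hγ)
  have h := additive_map_pow hu γ n
  rw [hγn] at h
  have h0 : u 1 = 0 := by simpa using additive_map_pow hu γ 0
  rw [h0] at h
  have hn' : (n : K) ≠ 0 := Nat.cast_ne_zero.mpr hn.ne'
  exact (mul_eq_zero.mp h.symm).resolve_left hn'

/-- In characteristic `0`, an additive `u : Γ → K` killing the parabolic elements is a parabolic–torsion cocycle. [folklore] -/
theorem mem_parTorsCocycles_of_charZero [CharZero K] {u : Γ → K} (hu : ∀ γ δ : Γ, u (γ * δ) = u γ + u δ)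
    (hpar : ∀ γ : Γ, ((γ : SL(2, ℤ)) : Matrix (Fin 2) (Fin 2) ℤ).IsParabolic → u γ = 0) : u ∈ parTorsCocycles K Γ :=
  ⟨hu, hpar, fun _ hγ ↦ additive_eq_zero_of_isOfFinOrder hu hγ⟩

/-! ### `Λ` is onto the unrefined solution space (characteristic `0`) -/

section Finite

variable [Γ.FiniteIndex]

/-- **`W₀ ⊆ range Λ`** in characteristic `0`: every solution `(a, b)` is `((E_u + δf)(S), (E_u + δf)(T))` for a parabolic–torsion cocycle `u` and some
`f ∈ K^X` (`exists_rc`, `rc_apply_coe_one_eq_zero_of_isParabolic`, `rc_eq_tot`, torsion automatic). [cite: ShimuraIATAF1971, §8.1–8.2] -/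
theorem solSpace₀_le_range_lam [CharZero K] [Fact ((-1 : SL(2, ℤ)) ∈ Γ)] :
    solSpace₀ K Γ ≤ LinearMap.range (lam K Γ) := by
  rintro ⟨a, b⟩ hp
  obtain ⟨ha, hab, hb⟩ := (mem_solSpace₀_iff _).mp hp
  obtain ⟨E, hE, hES, hET⟩ := exists_rc ha hab
  have hcusp : cuspSum K Γ (E T) = 0 := by rw [hET]; exact hb
  have hpar : (fun γ : Γ ↦ E γ ((1 : SL(2, ℤ)) : (SL(2, ℤ) ⧸ Γ))) ∈ parTorsCocycles K Γ :=
    mem_parTorsCocycles_of_charZero (fun γ δ ↦ rc_apply_coe_one_mul hE γ δ)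
      fun γ hγ ↦ rc_apply_coe_one_eq_zero_of_isParabolic hE hcusp γ hγ
  obtain ⟨f, hf⟩ := rc_eq_tot hE
  refine ⟨(⟨_, hpar⟩, f), ?_⟩
  rw [lam_apply, Prod.mk.injEq]
  exact ⟨(hf S).symm.trans hES, (hf T).symm.trans hET⟩

/-- **`range Λ = W₀`** in characteristic `0` (and hence `= W`, the refined solution space of part D). [cite: ShimuraIATAF1971, §8.2] -/
theorem range_lam_eq_solSpace₀ [CharZero K] [Fact ((-1 : SL(2, ℤ)) ∈ Γ)] : LinearMap.range (lam K Γ) = solSpace₀ K Γ :=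
  le_antisymm ((range_lam_le K Γ).trans solSpace_le_solSpace₀) solSpace₀_le_range_lam

/-- **`dim ker Λ = 1`** (`(0, 1) ∈ ker Λ`, and part D's `finrank_ker_lam_le_one`). [folklore] -/
theorem finrank_ker_lam_eq_one : finrank K (LinearMap.ker (lam K Γ)) = 1 := by
  refine le_antisymm (finrank_ker_lam_le_one K Γ) ?_
  haveI := finite_parTorsCocycles K Γ
  have htot : ∀ g : SL(2, ℤ), tot ((0 : parTorsCocycles K Γ) : Γ → K) (fun _ : SL(2, ℤ) ⧸ Γ ↦ (1 : K)) g = 0 := fun g ↦ by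
    funext x
    simp [tot, cobd]
  have hmem : ((0 : parTorsCocycles K Γ), fun _ : SL(2, ℤ) ⧸ Γ ↦ (1 : K)) ∈ LinearMap.ker (lam K Γ) := by
    rw [LinearMap.mem_ker, lam_apply, htot S, htot T]
    rfl
  have hne : ((0 : parTorsCocycles K Γ), fun _ : SL(2, ℤ) ⧸ Γ ↦ (1 : K)) ≠ 0 := by
    intro h
    have h' := congrArg (fun p : parTorsCocycles K Γ × ((SL(2, ℤ) ⧸ Γ) → K) ↦ p.2 ((1 : SL(2, ℤ)) : (SL(2, ℤ) ⧸ Γ))) h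
    simp at h'
  have hle : (K ∙ ((0 : parTorsCocycles K Γ), fun _ : SL(2, ℤ) ⧸ Γ ↦ (1 : K))) ≤ LinearMap.ker (lam K Γ) := by
    rw [Submodule.span_singleton_le_iff_mem]
    exact hmem
  calc 1 = finrank K (K ∙ ((0 : parTorsCocycles K Γ), fun _ : SL(2, ℤ) ⧸ Γ ↦ (1 : K))) := (finrank_span_singleton hne).symm
    _ ≤ finrank K (LinearMap.ker (lam K Γ)) := Submodule.finrank_mono hle

/-! ### The exact count -/

/-- **`6 dim_K H¹_{par,tors}(Γ, K) + 3ν₂ + 4ν₃ + 6ε_∞ = 12 + [SL(2, ℤ) : Γ]`** for every finite-index level `Γ ∋ -1` and every field `K` of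
characteristic `0` (`ν₂ = Level.nu₂Level Γ`, `ν₃ = Level.nu₃Level Γ`, `ε_∞ = #Level.basePoints Γ`), i.e. `dim_K H¹_{par,tors}(Γ, K) = 2g(X_Γ)`:
`dim H + μ = dim ker Λ + dim W₀ = 1 + (μ - rk(1 + S^*)) + (μ - rk(1 + U + U²)) + (μ - ε_∞) - (μ - 1)` with the trace counts of part E.
[cite: ShimuraIATAF1971, §8.2 (8.2.24), Prop. 8.1 (n = 0), Prop. 1.40] -/
theorem six_mul_finrank_parTorsCocycles_eq [CharZero K] (hneg : (-1 : SL(2, ℤ)) ∈ Γ) :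
    6 * finrank K (parTorsCocycles K Γ) + 3 * Level.nu₂Level Γ + 4 * Level.nu₃Level Γ + 6 * (Level.basePoints Γ).card =
      12 + Γ.index := by
  letI : Fintype (SL(2, ℤ) ⧸ Γ) := Fintype.ofFinite _
  haveI : Fact ((-1 : SL(2, ℤ)) ∈ Γ) := ⟨hneg⟩
  haveI := finite_parTorsCocycles K Γ
  have hμ : Γ.index = Fintype.card (SL(2, ℤ) ⧸ Γ) := by
    rw [Subgroup.index, Nat.card_eq_fintype_card]
  have hε₂ : Level.nu₂Level Γ = (Finset.univ.filter fun q : (SL(2, ℤ) ⧸ Γ) ↦ S • q = q).card := by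
    rw [Level.nu₂Level, Nat.card_eq_fintype_card, Fintype.card_subtype]
  have hε₃ : Level.nu₃Level Γ = (Finset.univ.filter fun q : (SL(2, ℤ) ⧸ Γ) ↦ (S * T) • q = q).card := by
    rw [Level.nu₃Level, Nat.card_eq_fintype_card, Fintype.card_subtype]
  have hS := two_mul_finrank_range_relS (K := K) (Γ := Γ)
  have hST := three_mul_finrank_range_relST (K := K) (Γ := Γ)
  have hC := finrank_range_cuspSum (K := K) (Γ := Γ)
  have hS' := LinearMap.finrank_range_add_finrank_ker (relS K Γ)
  have hST' := LinearMap.finrank_range_add_finrank_ker (relST K Γ)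
  have hC' := LinearMap.finrank_range_add_finrank_ker (cuspSum K Γ)
  rw [finrank_fintype_fun_eq_card] at hS' hST' hC'
  have hsup := Submodule.finrank_sup_add_finrank_inf_eq (LinearMap.ker (relST K Γ)) (LinearMap.ker (cuspSum K Γ))
  rw [ker_sup_ker_eq_ker_total] at hsup
  have hcodim := finrank_ker_total_add_one (K := K) (Γ := Γ)
  have hΛ := LinearMap.finrank_range_add_finrank_ker (lam K Γ)
  rw [Module.finrank_prod, finrank_fintype_fun_eq_card, range_lam_eq_solSpace₀, finrank_ker_lam_eq_one, finrank_solSpace₀_eq] at hΛ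
  rw [hμ, hε₂, hε₃]
  omega

/-- **The torsion-refined count is SHARP in characteristic `0`**: the inequality `six_mul_finrank_parTorsCocycles_le'` of part D is an equality for
`char K = 0`; equivalently `dim_K H¹_{par,tors}(Γ, K)` for `char K = 0` bounds `dim_L H¹_{par,tors}(Γ, L)` for EVERY field `L`. [folklore] -/
theorem finrank_parTorsCocycles_le_of_charZero [CharZero K] {L : Type*} [Field L] (hneg : (-1 : SL(2, ℤ)) ∈ Γ) :
    finrank L (parTorsCocycles L Γ) ≤ finrank K (parTorsCocycles K Γ) := by
  have h₁ := six_mul_finrank_parTorsCocycles_le' (K := L) (Γ := Γ) hneg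
  have h₂ := six_mul_finrank_parTorsCocycles_eq (K := K) (Γ := Γ) hneg
  omega

end Finite

end Summit.BirchSwinnertonDyer.BirchSwinnertonDyer.Theorems.EichlerShimuraLevelK

end
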